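import Summits.ValiantsHypothesis.ValiantsHypothesis.Theorems.PolyaContinuedLaplaceRigiditySingCodimThreeByFour
import Summits.ValiantsHypothesis.ValiantsHypothesis.Theorems.SymPencilPerFourSingularLocusSupportPatterns
import Literature.Computability.AlgebraicComplexity.ABV17SingPermFourCodim
import Mathlib.RingTheory.Localization.FractionRing

/-!
# `codim Sing(per₄) = 8` exactly (Alper–Bogart–Velasco 2017, §1; the missing unit `8 ≤`)

Alper, Bogart and Velasco (Found. Comput. Math. 17 (2017), §1, arXiv:1505.02205 p0003 L38) report
"`codim(Sing(perm_4)) = 8`" by a Macaulay2 computation; equivalently (zero-row stratum) Boralevi–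
Carlini–Michałek–Ventura 2025 Prop. 3.10 (`k = 3`) / Kirkup: `codim P_{3,4} = 4`, also by Macaulay2.
The tree had `7 ≤ height ≤ 8` (`AlperBogartVelasco.height_singIdeal_perPoly_four_bounds`, and over
`ℂ` `SymPencilPerFourSingularLocusHeight.seven_le_height_singPermIdeal_four`).  This file PROVES the
exact value, over every field with `2 ≠ 0` and `3 ≠ 0`, WITHOUT computer algebra, certificates or
`native_decide`:

* `trdeg_le_eight_of_threeByThree_vanish` — a `4 × 4` point `z` over a field `L ⊇ F` with all
  sixteen `3 × 3` sub-permanents vanishing has `trdeg_F F[z] ≤ 8`: by the SUPPORT THEOREM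
  (`SymPencilPerFourSingularLocusSupportPatterns.support_of_subperm_vanish`, val-idea-10 g2, cited by
  name) `z` has a zero row or column — then the other three rows form a point of `P_{3,4}` and
  `…ThreeByFour.trdeg_le_eight_threeByFour` applies — or an anti-block / cross zero pattern with at
  least eight zeros;
* `eight_le_height_of_subpermIdeal_four_le` — every prime over the `3 × 3` permanents of the
  generic `4 × 4` matrix has height `≥ 8` (generic point in the fraction field of `F[X]/P`, and the
  bridge `…Tools.natCast_sub_le_height_ker_aeval`);
* `eight_le_height_singPermIdeal_four`, **`height_singPermIdeal_four`**:
  `(VonZurGathen.singPermIdeal F 4).height = 8`, and `height_singIdeal_perPoly_four`: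
  `codim Sing(per₄) = (singIdeal (perPoly (Fin 4) F)).height = 8`.

For line `laplace_rigidity` (crux `CoverDecancellation`, stmt-ValiantsHypothesis-17819) this is the
R3-row number `codim Sing(per₄) = 8` made kernel-exact; by Gesmundo–Ghosal–Ikenmeyer–Lysikov
Prop. 6 it yields `str₂(per₄) ≥ ⌈8/2⌉ = 4`, the same floor as `7`, so NO rung moves: the rung
`StrengthTwoPerFour` (stmt-25160, `str₂(per₄) = 6`) stays open, `CoverDecancellation` stays HELD,
and VP ≠ VNP is NOT proved.  No summit statement is touched.  val-width-17819-w1 g0, 2026-08-28.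

## References
* J. Alper, T. Bogart, M. Velasco, *A lower bound for the determinantal complexity of a
  hypersurface*, Found. Comput. Math. 17 (2017) 829–836, arXiv:1505.02205, §1 (p0003 L38) and
  Rem. 1.5. [AlperBogartVelasco2017]
* A. Boralevi, E. Carlini, M. Michałek, E. Ventura, *On the codimension of permanental varieties*,
  Adv. Math. 461 (2025) 110079, arXiv:2402.17839, Prop. 3.10, §3.1. [BoraleviCarliniMichalekVentura2025]
* J. von zur Gathen, *Permanent and determinant*, Linear Algebra Appl. 96 (1987) 87–100, §2
  (the problem `codim Sing(per_k) = ?`). [Vonzurgathen1987]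
-/

set_option linter.dupNamespace false

noncomputable section

namespace Summit.ValiantsHypothesis.ValiantsHypothesis.Theorems.PolyaContinuedLaplaceRigidity.SingCodim

open MvPolynomial Cardinal Matrix
open Summit.ValiantsHypothesis.ValiantsHypothesis.Theorems.SymPencilPerFourHessianRankThreeZero (eq_or_of_four)
open Literature.Computability.AlgebraicComplexity
open Literature.Computability.AlgebraicComplexity.BoraleviCarliniMichalekVentura2025
open Summit.ValiantsHypothesis.ValiantsHypothesis.Theorems.SymPencilPerFourSingularLocusSupportPatterns

variable {F : Type*} [Field F] {L : Type*} [Field L] [Algebra F L]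

/-! ### `Fin 4` bookkeeping and the explicit `3 × 3` minors -/

/-- `x ≠ a` iff `x` is one of the other three indices. -/
theorem ne_iff_eq_three (a b c d : Fin 4) (hab : a ≠ b) (hac : a ≠ c) (had : a ≠ d)
    (hbc : b ≠ c) (hbd : b ≠ d) (hcd : c ≠ d) (x : Fin 4) :
    x ≠ a ↔ (x = b ∨ x = c ∨ x = d) := by
  revert a b c d x; decide

/-- `x ≠ a` iff `x` is one of the other three indices (finset form). -/
theorem ne_iff_mem_three (a b c d : Fin 4) (hab : a ≠ b) (hac : a ≠ c) (had : a ≠ d)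
    (hbc : b ≠ c) (hbd : b ≠ d) (hcd : c ≠ d) (x : Fin 4) :
    x ≠ a ↔ x ∈ ({b, c, d} : Finset (Fin 4)) := by
  rw [ne_iff_eq_three a b c d hab hac had hbc hbd hcd x]
  simp only [Finset.mem_insert, Finset.mem_singleton]

/-- The `3 × 3` minor of a `4 × 4` matrix complementary to `(i, a)`, written out: rows `j, k, l`,
columns `b, c, d`, expanded along row `j`. [folklore] -/
theorem permanent_submatrix_succAbove_eq {R : Type*} [CommRing R] (N : Matrix (Fin 4) (Fin 4) R)
    {i j k l a b c d : Fin 4} (hij : i ≠ j) (hik : i ≠ k) (hil : i ≠ l) (hjk : j ≠ k) (hjl : j ≠ l)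
    (hkl : k ≠ l) (hab : a ≠ b) (hac : a ≠ c) (had : a ≠ d) (hbc : b ≠ c) (hbd : b ≠ d)
    (hcd : c ≠ d) :
    (N.submatrix i.succAbove a.succAbove).permanent =
      N j b * (N k c * N l d + N k d * N l c) + N j c * (N k b * N l d + N k d * N l b) +
        N j d * (N k b * N l c + N k c * N l b) := by
  classical
  rw [permanent_minor_eq_subperm,
    N.subperm_congr (p' := (· ∈ ({b, c, d} : Finset (Fin 4))))
      (q' := (· ∈ ({j, k, l} : Finset (Fin 4))))
      (fun x => ne_iff_mem_three a b c d hab hac had hbc hbd hcd x)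
      (fun x => ne_iff_mem_three i j k l hij hik hil hjk hjl hkl x),
    AlperBogartVelasco.subperm_triple N hjk hjl hkl hbc hbd hcd]

/-- The anti-block complement has eight cells. -/
theorem card_filter_antiblock_le (i₁ i₂ j₁ j₂ : Fin 4) (hi : i₁ ≠ i₂) (hj : j₁ ≠ j₂) :
    (Finset.univ.filter fun x : Fin 4 × Fin 4 =>
      ¬ ((x.1 = i₁ ∨ x.1 = i₂) ↔ (x.2 = j₁ ∨ x.2 = j₂))).card ≤ 8 := by
  revert i₁ i₂ j₁ j₂; decide

/-- A cross has seven cells. -/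
theorem card_filter_cross_le (i₀ j₀ : Fin 4) :
    (Finset.univ.filter fun x : Fin 4 × Fin 4 => x.1 = i₀ ∨ x.2 = j₀).card ≤ 8 := by
  revert i₀ j₀; decide

/-! ### The point statement -/

section Point

variable (z : Fin 4 × Fin 4 → L)

/-- **Zero row.**  If row `i` of `z` vanishes and all `3 × 3` sub-permanents avoiding row `i`
vanish (explicit form), then `trdeg_F F[z] ≤ 8` — the other three rows are a point of `P_{3,4}`.
[cite: BoraleviCarliniMichalekVentura2025, Prop. 3.10] -/
theorem trdeg_le_eight_of_row_eq_zero (h2 : (2 : L) ≠ 0) (i : Fin 4) (hrow : ∀ j, z (i, j) = 0)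
    (hvan : ∀ r₀ r₁ r₂ c₀ c₁ c₂ : Fin 4, r₀ ≠ r₁ → r₀ ≠ r₂ → r₁ ≠ r₂ → c₀ ≠ c₁ → c₀ ≠ c₂ →
      c₁ ≠ c₂ →
      z (r₀, c₀) * (z (r₁, c₁) * z (r₂, c₂) + z (r₁, c₂) * z (r₂, c₁)) +
        z (r₀, c₁) * (z (r₁, c₀) * z (r₂, c₂) + z (r₁, c₂) * z (r₂, c₀)) +
        z (r₀, c₂) * (z (r₁, c₀) * z (r₂, c₁) + z (r₁, c₁) * z (r₂, c₀)) = 0) :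
    Algebra.trdeg F (Algebra.adjoin F (Set.range z)) ≤ 8 := by
  obtain ⟨j, k, l, hij, hik, hil, hjk, hjl, hkl⟩ := exists_three_others i
  have key := trdeg_le_eight_threeByFour (F := F) h2 (fun c => z (j, c)) (fun c => z (k, c))
    (fun c => z (l, c)) (fun b c d hbc hbd hcd => hvan j k l b c d hjk hjl hkl hbc hbd hcd)
  refine le_trans (trdeg_adjoin_le_trdeg_of_forall_alg fun e he => ?_) key
  obtain ⟨⟨x, y⟩, rfl⟩ := he
  rcases eq_or_of_four i j k l hij hik hil hjk hjl hkl x with rfl | rfl | rfl | rfl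
  · exact alg_of_eq_zero _ (hrow y)
  · exact alg_of_mem (Or.inl (Or.inl ⟨y, rfl⟩))
  · exact alg_of_mem (Or.inl (Or.inr ⟨y, rfl⟩))
  · exact alg_of_mem (Or.inr ⟨y, rfl⟩)

/-- **The point statement: `trdeg_F F[z] ≤ 8` on `Sing(per₄)`.**  For a `4 × 4` point `z` over a
field `L ⊇ F` with `2 ≠ 0`, `3 ≠ 0`, all of whose sixteen `3 × 3` sub-permanents vanish,
`trdeg_F F[z] ≤ 8`.  The support theorem gives a zero row (previous lemma), a zero column
(transpose), or an anti-block / cross zero pattern (at least eight zero coordinates).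
[cite: AlperBogartVelasco2017, §1 (arXiv text p0003 L38)] -/
theorem trdeg_le_eight_of_threeByThree_vanish (h2 : (2 : L) ≠ 0) (h3 : (3 : L) ≠ 0)
    (hvan : ∀ r₀ r₁ r₂ c₀ c₁ c₂ : Fin 4, r₀ ≠ r₁ → r₀ ≠ r₂ → r₁ ≠ r₂ → c₀ ≠ c₁ → c₀ ≠ c₂ →
      c₁ ≠ c₂ →
      z (r₀, c₀) * (z (r₁, c₁) * z (r₂, c₂) + z (r₁, c₂) * z (r₂, c₁)) +
        z (r₀, c₁) * (z (r₁, c₀) * z (r₂, c₂) + z (r₁, c₂) * z (r₂, c₀)) +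
        z (r₀, c₂) * (z (r₁, c₀) * z (r₂, c₁) + z (r₁, c₁) * z (r₂, c₀)) = 0) :
    Algebra.trdeg F (Algebra.adjoin F (Set.range z)) ≤ 8 := by
  classical
  have h12 : (12 : L) ≠ 0 := by
    rw [show (12 : L) = 2 * 2 * 3 by norm_num]
    exact mul_ne_zero (mul_ne_zero h2 h2) h3
  -- matrix form of the hypothesis
  set M : Matrix (Fin 4) (Fin 4) L := Matrix.of fun i j => z (i, j) with hM
  have hmat : ∀ r c : Fin 4, (M.submatrix r.succAbove c.succAbove).permanent = 0 := by
    intro r c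
    obtain ⟨j, k, l, hrj, hrk, hrl, hjk, hjl, hkl⟩ := exists_three_others r
    obtain ⟨b, c', d, hcb, hcc, hcd', hbc, hbd, hcd⟩ := exists_three_others c
    rw [permanent_submatrix_succAbove_eq M hrj hrk hrl hjk hjl hkl hcb hcc hcd' hbc hbd hcd]
    simp only [hM, Matrix.of_apply]
    exact hvan j k l b c' d hjk hjl hkl hbc hbd hcd
  rcases support_of_subperm_vanish (R := L) h12 M hmat with
    ⟨i, hi⟩ | ⟨j, hj⟩ | ⟨i₁, i₂, j₁, j₂, hi, hj, hz⟩ | ⟨i₀, j₀, hz⟩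
  · -- zero row
    exact trdeg_le_eight_of_row_eq_zero z h2 i (fun j => by simpa [hM] using hi j) hvan
  · -- zero column: transpose
    set zT : Fin 4 × Fin 4 → L := fun x => z (x.2, x.1) with hzT
    have hrange : Set.range zT = Set.range z := by
      ext e
      constructor
      · rintro ⟨⟨a, b⟩, rfl⟩; exact ⟨(b, a), rfl⟩
      · rintro ⟨⟨a, b⟩, rfl⟩; exact ⟨(b, a), rfl⟩
    rw [← hrange]
    refine trdeg_le_eight_of_row_eq_zero zT h2 j (fun i => by simpa [hM, hzT] using hj i) ?_
    intro r₀ r₁ r₂ c₀ c₁ c₂ h₀₁ h₀₂ h₁₂ k₀₁ k₀₂ k₁₂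
    simp only [hzT]
    linear_combination hvan c₀ c₁ c₂ r₀ r₁ r₂ k₀₁ k₀₂ k₁₂ h₀₁ h₀₂ h₁₂
  · -- anti-block: eight zeros
    set T : Finset (Fin 4 × Fin 4) := Finset.univ.filter fun x : Fin 4 × Fin 4 =>
      ¬ ((x.1 = i₁ ∨ x.1 = i₂) ↔ (x.2 = j₁ ∨ x.2 = j₂)) with hT
    refine trdeg_adjoin_le_nat_of_forall_alg (T := T.image z)
      (Finset.card_image_le.trans (card_filter_antiblock_le i₁ i₂ j₁ j₂ hi hj)) fun e he => ?_
    obtain ⟨x, rfl⟩ := he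
    by_cases hx : (x.1 = i₁ ∨ x.1 = i₂) ↔ (x.2 = j₁ ∨ x.2 = j₂)
    · exact alg_of_eq_zero _ (by simpa [hM] using hz x.1 x.2 hx)
    · refine alg_of_mem ?_
      rw [Finset.coe_image]
      exact ⟨x, by simp [hT, hx], rfl⟩
  · -- cross: nine zeros
    set T : Finset (Fin 4 × Fin 4) := Finset.univ.filter fun x : Fin 4 × Fin 4 =>
      x.1 = i₀ ∨ x.2 = j₀ with hT
    refine trdeg_adjoin_le_nat_of_forall_alg (T := T.image z)
      (Finset.card_image_le.trans (card_filter_cross_le i₀ j₀)) fun e he => ?_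
    obtain ⟨x, rfl⟩ := he
    by_cases hx : x.1 = i₀ ∨ x.2 = j₀
    · refine alg_of_mem ?_
      rw [Finset.coe_image]
      exact ⟨x, by simp [hT, hx], rfl⟩
    · push Not at hx
      exact alg_of_eq_zero _ (by simpa [hM] using hz x.1 x.2 hx.1 hx.2)

end Point

/-! ### The height statements -/

/-- **Every prime over the `3 × 3` permanents of the generic `4 × 4` matrix has height `≥ 8`**
(`2 ≠ 0`, `3 ≠ 0` in `F`): the generic point of `P` in the fraction field of `F[X]/P` is a `4 × 4`
point with vanishing `3 × 3` sub-permanents and `height P = 16 - trdeg ≥ 16 - 8`.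
[cite: AlperBogartVelasco2017, §1 (arXiv text p0003 L38)] -/
theorem eight_le_height_of_subpermIdeal_four_le (F : Type*) [Field F] (h2 : (2 : F) ≠ 0)
    (h3 : (3 : F) ≠ 0) (P : Ideal (MvPolynomial (Fin 4 × Fin 4) F)) [hP : P.IsPrime]
    (hle : subpermIdeal F 4 4 3 ≤ P) : (8 : ℕ∞) ≤ P.height := by
  classical
  haveI : IsDomain (MvPolynomial (Fin 4 × Fin 4) F ⧸ P) := Ideal.Quotient.isDomain P
  let Lf := FractionRing (MvPolynomial (Fin 4 × Fin 4) F ⧸ P)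
  let z : Fin 4 × Fin 4 → Lf := fun x =>
    algebraMap (MvPolynomial (Fin 4 × Fin 4) F ⧸ P) Lf (Ideal.Quotient.mk P (X x))
  -- `aeval z = (A/P → Frac) ∘ (mk P)`
  have haeval : ∀ p : MvPolynomial (Fin 4 × Fin 4) F,
      aeval z p = algebraMap _ Lf (Ideal.Quotient.mk P p) := by
    intro p
    have h : (aeval (R := F) z : MvPolynomial (Fin 4 × Fin 4) F →ₐ[F] Lf) =
        (IsScalarTower.toAlgHom F (MvPolynomial (Fin 4 × Fin 4) F ⧸ P) Lf).comp
          (Ideal.Quotient.mkₐ F P) :=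
      MvPolynomial.algHom_ext fun x => by simp [z]
    exact congrArg (fun φ : MvPolynomial (Fin 4 × Fin 4) F →ₐ[F] Lf => φ p) h
  have hker : RingHom.ker (aeval (R := F) z) = P := by
    ext p
    rw [RingHom.mem_ker, haeval, map_eq_zero_iff _ (IsFractionRing.injective _ _),
      Ideal.Quotient.eq_zero_iff_mem]
  -- the sub-permanents vanish at `z`
  have hvan : ∀ r₀ r₁ r₂ c₀ c₁ c₂ : Fin 4, r₀ ≠ r₁ → r₀ ≠ r₂ → r₁ ≠ r₂ → c₀ ≠ c₁ → c₀ ≠ c₂ →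
      c₁ ≠ c₂ →
      z (r₀, c₀) * (z (r₁, c₁) * z (r₂, c₂) + z (r₁, c₂) * z (r₂, c₁)) +
        z (r₀, c₁) * (z (r₁, c₀) * z (r₂, c₂) + z (r₁, c₂) * z (r₂, c₀)) +
        z (r₀, c₂) * (z (r₁, c₀) * z (r₂, c₁) + z (r₁, c₁) * z (r₂, c₀)) = 0 := by
    intro r₀ r₁ r₂ c₀ c₁ c₂ h₀₁ h₀₂ h₁₂ k₀₁ k₀₂ k₁₂
    have hRc : ({r₀, r₁, r₂} : Finset (Fin 4)).card = 3 := by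
      rw [Finset.card_insert_of_notMem (by simp [h₀₁, h₀₂]), Finset.card_pair h₁₂]
    have hCc : ({c₀, c₁, c₂} : Finset (Fin 4)).card = 3 := by
      rw [Finset.card_insert_of_notMem (by simp [k₀₁, k₀₂]), Finset.card_pair k₁₂]
    have hmem : rsubperm (mvPolynomialX (Fin 4) (Fin 4) F) (· ∈ ({c₀, c₁, c₂} : Finset (Fin 4)))
        (· ∈ ({r₀, r₁, r₂} : Finset (Fin 4))) ∈ P :=
      hle (rsubperm_mem_subpermIdeal hRc hCc)
    rw [← hker, RingHom.mem_ker, aeval_rsubperm_X,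
      AlperBogartVelasco.rsubperm_triple _ h₀₁ h₀₂ h₁₂ k₀₁ k₀₂ k₁₂]
      at hmem
    simpa only [Matrix.of_apply] using hmem
  have h2L : (2 : Lf) ≠ 0 := by
    intro h
    apply h2
    have hinj := (algebraMap F Lf).injective
    apply hinj
    rw [map_ofNat, map_zero, h]
  have h3L : (3 : Lf) ≠ 0 := by
    intro h
    apply h3
    have hinj := (algebraMap F Lf).injective
    apply hinj
    rw [map_ofNat, map_zero, h]
  have h8 := natCast_sub_le_height_ker_aeval (F := F) z (d := 8)
    (trdeg_le_eight_of_threeByThree_vanish z h2L h3L hvan)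
  rw [hker] at h8
  simpa using h8

/-- **`8 ≤ codim Sing(per₄)`** in the tree's height currency: `8 ≤ ht (per₄, ∂per₄/∂x_ij)` over
every field with `2 ≠ 0`, `3 ≠ 0` (`singPermIdeal F 4 = subpermIdeal F 4 4 3`,
`singPermIdeal_eq_subpermIdeal`).  The printed value `8` (Macaulay2) is thereby PROVED; the tree's
earlier `seven_le_height_singPermIdeal_four` is superseded.
[cite: AlperBogartVelasco2017, §1 (arXiv text p0003 L38)] -/
theorem eight_le_height_singPermIdeal_four (F : Type*) [Field F] (h2 : (2 : F) ≠ 0)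
    (h3 : (3 : F) ≠ 0) : (8 : ℕ∞) ≤ (VonZurGathen.singPermIdeal F 4).height := by
  rw [singPermIdeal_eq_subpermIdeal F (m := 4) (by norm_num), Ideal.height_eq_inf_minimalPrimes]
  refine le_iInf₂ fun P hP => ?_
  haveI := hP.1.1
  exact eight_le_height_of_subpermIdeal_four_le F h2 h3 P hP.1.2

/-- **Alper–Bogart–Velasco 2017, §1: `codim(Sing(perm_4)) = 8`** — `(singPermIdeal F 4).height = 8`
over every field with `2 ≠ 0`, `3 ≠ 0`: `8 ≤` above, `≤ 8` is the tree's
`alperBogartVelasco2017_rem_1_5` (two zero rows).  First exact value of von zur Gathen's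
`codim Sing(per_k)` beyond `k = 3` in the tree, machine-checked without computer algebra.
[cite: AlperBogartVelasco2017, §1 (arXiv text p0003 L38) and Rem. 1.5] -/
theorem height_singPermIdeal_four (F : Type*) [Field F] (h2 : (2 : F) ≠ 0) (h3 : (3 : F) ≠ 0) :
    (VonZurGathen.singPermIdeal F 4).height = 8 := by
  refine le_antisymm ?_ (eight_le_height_singPermIdeal_four F h2 h3)
  have h := alperBogartVelasco2017_rem_1_5 F (n := 4) (by norm_num)
  rw [singIdeal_perPoly] at h
  exact_mod_cast h

/-- The same in the `singIdeal` currency of `ABV17SingularLocusBound` (`codim Sing(f) =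
(singIdeal f).height`): **`codim Sing(per₄) = 8`**.
[cite: AlperBogartVelasco2017, §1 (arXiv text p0003 L38) and Rem. 1.5] -/
theorem height_singIdeal_perPoly_four (F : Type*) [Field F] (h2 : (2 : F) ≠ 0) (h3 : (3 : F) ≠ 0) :
    (singIdeal (perPoly (Fin 4) F)).height = 8 := by
  rw [singIdeal_perPoly]
  exact height_singPermIdeal_four F h2 h3

/-- Over `ℂ` (the case of line `laplace_rigidity`): `codim Sing(per₄) = 8`, hypothesis-free.
[cite: AlperBogartVelasco2017, §1 (arXiv text p0003 L38)] -/
theorem height_singPermIdeal_four_complex : (VonZurGathen.singPermIdeal ℂ 4).height = 8 :=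
  height_singPermIdeal_four ℂ (by norm_num) (by norm_num)

end Summit.ValiantsHypothesis.ValiantsHypothesis.Theorems.PolyaContinuedLaplaceRigidity.SingCodim

end
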